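import Mathlib
import HarnessLib

/-!
# PneNP / OverlapGapAlgebra — `SearchHardWindow`: occurrence-local rung, variable-pattern statistics

Support for crux `stmt-PneNP-2460` (`Summit.PneNP.PneNP.Theses.OverlapGapAlgebra.SearchHardWindow`),
third file of the OCCURRENCE-LOCAL RUNG (prefix `shwL_`; see `…LocalRungCore.lean`,
`…LocalRungSigns.lean`, `…LocalRung.lean`). Elementary counting over the uniform variable pattern
`V : Fin m × Fin k → Fin n` of `F_k(n, m)` (all `k m` slots i.i.d. uniform), by injections and
Markov's inequality in counting form:

* `shwL_mul_card_coincide_le` — two fixed distinct slots carry the same variable in at most a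
  `1/n` fraction of the patterns;
* `shwL_card_highDegree_mul_le` — patterns with a variable of degree `≥ t` are at most a
  `(mk·n + (mk)²)/(t²·n)` fraction (Markov on coinciding ordered slot pairs);
* `shwL_card_manyRepeats_mul_le` — patterns with `≥ r` clauses repeating a variable are at most
  a `m k²/(r n)` fraction;
* `shwL_card_inst_eq`, `shwL_card_solved_eq_sum` — instances `Fin m → Fin k → Fin n × Bool`
  correspond to (variable pattern, sign pattern) pairs; fibre decomposition of the solved set.

No definitions; axioms `propext`, `Classical.choice`, `Quot.sound`.
-/

set_option linter.dupNamespace false -- `Summit.PneNP.PneNP.…`: summit = sub-problem (D-0017)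

namespace Summit.PneNP.PneNP.Theorems

open Finset

section VariablePattern

variable {σ : Type*} [Fintype σ] [DecidableEq σ] {n : ℕ}

/-- **One coincidence costs a factor `n`.** For two distinct slots `a ≠ b`, at most a `1/n`
fraction of the variable patterns `V : σ → Fin n` have `V a = V b`:
`n · #{V : V a = V b} ≤ #(σ → Fin n)` (the map `(v, V) ↦ V[b ↦ v]` is injective on them). -/
theorem shwL_mul_card_coincide_le (a b : σ) (hab : a ≠ b) :
    n * (univ.filter fun V : σ → Fin n => V a = V b).card ≤ Fintype.card (σ → Fin n) := by
  have h := card_le_card_of_injOn (s := (univ : Finset (Fin n)) ×ˢ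
      (univ.filter fun V : σ → Fin n => V a = V b)) (t := (univ : Finset (σ → Fin n)))
    (fun p => Function.update p.2 b p.1) (fun p _ => mem_coe.2 (mem_univ _)) ?_
  · rwa [card_product, card_univ, Fintype.card_fin, card_univ] at h
  · rintro ⟨v, V⟩ hp ⟨v', V'⟩ hp' hEq
    simp only [coe_product, coe_univ, coe_filter, Set.mem_prod, Set.mem_univ, true_and,
      Set.mem_setOf_eq, mem_univ] at hp hp'
    have hv : v = v' := by
      have := congr_fun hEq b
      simpa using this
    subst hv
    have hrest : ∀ c, c ≠ b → V c = V' c := by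
      intro c hc
      have := congr_fun hEq c
      simpa [Function.update_of_ne hc] using this
    have hVb : V b = V' b := by rw [← hp, ← hp', hrest a hab]
    simp only [Prod.mk.injEq, true_and]
    funext c
    by_cases hc : c = b
    · subst hc; exact hVb
    · exact hrest c hc

end VariablePattern

section HighDegree

/-- **Few variable patterns have a high-degree variable (Markov on coinciding slot pairs).** The
variable patterns in which some variable occurs at least `t` times number at most
`(#σ · n + #σ²) / (t² · n)` of all: such a pattern has `≥ t²` ordered pairs of coinciding slots,
while on average there are `#σ + #σ(#σ - 1)/n ≤ #σ + #σ²/n` of them. -/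
theorem shwL_card_highDegree_mul_le {σ : Type*} [Fintype σ] [DecidableEq σ] {n : ℕ} (t : ℕ) :
    (univ.filter fun V : σ → Fin n =>
        ∃ v : Fin n, t ≤ (univ.filter fun a : σ => V a = v).card).card * t ^ 2 * n
      ≤ (Fintype.card σ * n + Fintype.card σ ^ 2) * Fintype.card (σ → Fin n) := by
  -- coinciding ordered pairs of a pattern
  set P : (σ → Fin n) → ℕ := fun V => (univ.filter fun p : σ × σ => V p.1 = V p.2).card with hP
  -- a high-degree pattern has many coinciding pairs
  have hhigh : ∀ V : σ → Fin n, (∃ v : Fin n, t ≤ (univ.filter fun a : σ => V a = v).card) →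
      t ^ 2 ≤ P V := by
    rintro V ⟨v, hv⟩
    calc t ^ 2 ≤ (univ.filter fun a : σ => V a = v).card ^ 2 := Nat.pow_le_pow_left hv 2
      _ = ((univ.filter fun a : σ => V a = v) ×ˢ (univ.filter fun a : σ => V a = v)).card := by
          rw [card_product, sq]
      _ ≤ P V := by
          refine card_le_card fun p hp => ?_
          simp only [mem_product, mem_filter, mem_univ, true_and] at hp
          simp only [mem_filter, mem_univ, true_and]
          rw [hp.1, hp.2]
  -- Markov
  have hmarkov : (univ.filter fun V : σ → Fin n =>
      ∃ v : Fin n, t ≤ (univ.filter fun a : σ => V a = v).card).card * t ^ 2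
        ≤ ∑ V : σ → Fin n, P V := by
    calc (univ.filter fun V : σ → Fin n =>
          ∃ v : Fin n, t ≤ (univ.filter fun a : σ => V a = v).card).card * t ^ 2
        = (univ.filter fun V : σ → Fin n =>
            ∃ v : Fin n, t ≤ (univ.filter fun a : σ => V a = v).card).card • t ^ 2 :=
          (smul_eq_mul _ _).symm
      _ ≤ ∑ V ∈ univ.filter (fun V : σ → Fin n =>
            ∃ v : Fin n, t ≤ (univ.filter fun a : σ => V a = v).card), P V :=
          card_nsmul_le_sum _ _ _ fun V hV => hhigh V (mem_filter.1 hV).2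
      _ ≤ ∑ V : σ → Fin n, P V :=
          sum_le_sum_of_subset_of_nonneg (filter_subset _ _) fun _ _ _ => Nat.zero_le _
  -- double counting: `Σ_V P V = Σ_p #{V : V p.1 = V p.2}`
  have hswap : ∑ V : σ → Fin n, P V
      = ∑ p : σ × σ, (univ.filter fun V : σ → Fin n => V p.1 = V p.2).card := by
    simp only [hP, card_filter]
    exact sum_comm
  -- each off-diagonal pair contributes `≤ #patterns / n`, each diagonal pair `#patterns`
  have hpair : ∀ p : σ × σ, n * (univ.filter fun V : σ → Fin n => V p.1 = V p.2).card
      ≤ (if p.1 = p.2 then n else 1) * Fintype.card (σ → Fin n) := by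
    rintro ⟨a, b⟩
    by_cases hab : a = b
    · subst hab
      simp only [if_true]
      exact Nat.mul_le_mul_left _ (card_le_univ _)
    · simp only [hab, if_false, one_mul]
      exact shwL_mul_card_coincide_le a b hab
  have hdiag : ∑ p : σ × σ, (if p.1 = p.2 then n else 1)
      ≤ Fintype.card σ * n + Fintype.card σ ^ 2 := by
    calc ∑ p : σ × σ, (if p.1 = p.2 then n else 1)
        ≤ ∑ p : σ × σ, ((if p.1 = p.2 then n else 0) + 1) := by
          refine sum_le_sum fun p _ => ?_
          split_ifs <;> omega
      _ = ∑ p : σ × σ, (if p.1 = p.2 then n else 0) + Fintype.card (σ × σ) := by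
          rw [sum_add_distrib, sum_const, card_univ, smul_eq_mul, mul_one]
      _ = (univ.filter fun p : σ × σ => p.1 = p.2).card * n + Fintype.card σ ^ 2 := by
          rw [← sum_filter, sum_const, smul_eq_mul, Fintype.card_prod, sq]
      _ ≤ Fintype.card σ * n + Fintype.card σ ^ 2 := by
          refine Nat.add_le_add_right (Nat.mul_le_mul_right _ ?_) _
          calc (univ.filter fun p : σ × σ => p.1 = p.2).card
              ≤ ((univ : Finset σ).image fun a => (a, a)).card := by
                refine card_le_card fun p hp => ?_
                simp only [mem_filter, mem_univ, true_and] at hp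
                exact mem_image.2 ⟨p.1, mem_univ _, by rw [Prod.ext_iff]; exact ⟨rfl, hp⟩⟩
            _ ≤ (univ : Finset σ).card := card_image_le
            _ = Fintype.card σ := card_univ
  calc (univ.filter fun V : σ → Fin n =>
        ∃ v : Fin n, t ≤ (univ.filter fun a : σ => V a = v).card).card * t ^ 2 * n
      ≤ (∑ V : σ → Fin n, P V) * n := Nat.mul_le_mul_right _ hmarkov
    _ = ∑ p : σ × σ, n * (univ.filter fun V : σ → Fin n => V p.1 = V p.2).card := by
        rw [hswap, sum_mul]; exact sum_congr rfl fun p _ => mul_comm _ _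
    _ ≤ ∑ p : σ × σ, (if p.1 = p.2 then n else 1) * Fintype.card (σ → Fin n) :=
        sum_le_sum fun p _ => hpair p
    _ = (∑ p : σ × σ, (if p.1 = p.2 then n else 1)) * Fintype.card (σ → Fin n) := by
        rw [sum_mul]
    _ ≤ (Fintype.card σ * n + Fintype.card σ ^ 2) * Fintype.card (σ → Fin n) :=
        Nat.mul_le_mul_right _ hdiag

end HighDegree

section Repeats

variable {m k n : ℕ}

/-- **Few clauses repeat a variable (Markov).** The variable patterns of `F_k(n, m)` in which at
least `r` clauses contain a repeated variable number at most `m k² / (r n)` of all: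
`#{V : r ≤ #repeating clauses} · r · n ≤ m · k² · #patterns`. -/
theorem shwL_card_manyRepeats_mul_le (r : ℕ) :
    (univ.filter fun V : Fin m × Fin k → Fin n =>
        r ≤ (univ.filter fun i : Fin m => ¬ Function.Injective fun j : Fin k => V (i, j)).card).card
        * r * n
      ≤ m * k ^ 2 * Fintype.card (Fin m × Fin k → Fin n) := by
  set R : (Fin m × Fin k → Fin n) → ℕ := fun V =>
    (univ.filter fun i : Fin m => ¬ Function.Injective fun j : Fin k => V (i, j)).card with hR
  -- Markov
  have hmarkov : (univ.filter fun V : Fin m × Fin k → Fin n => r ≤ R V).card * r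
      ≤ ∑ V : Fin m × Fin k → Fin n, R V := by
    calc (univ.filter fun V : Fin m × Fin k → Fin n => r ≤ R V).card * r
        = (univ.filter fun V : Fin m × Fin k → Fin n => r ≤ R V).card • r := (smul_eq_mul _ _).symm
      _ ≤ ∑ V ∈ univ.filter (fun V : Fin m × Fin k → Fin n => r ≤ R V), R V :=
          card_nsmul_le_sum _ _ _ fun V hV => (mem_filter.1 hV).2
      _ ≤ ∑ V : Fin m × Fin k → Fin n, R V :=
          sum_le_sum_of_subset_of_nonneg (filter_subset _ _) fun _ _ _ => Nat.zero_le _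
  -- double counting: `Σ_V R V = Σ_i #{V : clause i repeats a variable}`
  have hswap : ∑ V : Fin m × Fin k → Fin n, R V
      = ∑ i : Fin m, (univ.filter fun V : Fin m × Fin k → Fin n =>
          ¬ Function.Injective fun j : Fin k => V (i, j)).card := by
    simp only [hR, card_filter]
    exact sum_comm
  -- a repeating clause has a coinciding pair of its own slots: factor `n` each, `≤ k²` pairs
  have hclause : ∀ i : Fin m, n * (univ.filter fun V : Fin m × Fin k → Fin n =>
      ¬ Function.Injective fun j : Fin k => V (i, j)).card
        ≤ k ^ 2 * Fintype.card (Fin m × Fin k → Fin n) := by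
    intro i
    have hsub : (univ.filter fun V : Fin m × Fin k → Fin n =>
        ¬ Function.Injective fun j : Fin k => V (i, j))
          ⊆ (univ.filter fun q : Fin k × Fin k => q.1 ≠ q.2).biUnion fun q =>
              univ.filter fun V : Fin m × Fin k → Fin n => V (i, q.1) = V (i, q.2) := by
      intro V hV
      simp only [mem_filter, mem_univ, true_and, Function.Injective, not_forall] at hV
      obtain ⟨j, j', hjj', hne⟩ := hV
      simp only [mem_biUnion, mem_filter, mem_univ, true_and]
      exact ⟨(j, j'), hne, hjj'⟩
    calc n * (univ.filter fun V : Fin m × Fin k → Fin n =>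
            ¬ Function.Injective fun j : Fin k => V (i, j)).card
        ≤ n * ∑ q ∈ univ.filter (fun q : Fin k × Fin k => q.1 ≠ q.2),
            (univ.filter fun V : Fin m × Fin k → Fin n => V (i, q.1) = V (i, q.2)).card :=
          Nat.mul_le_mul_left _ ((card_le_card hsub).trans card_biUnion_le)
      _ = ∑ q ∈ univ.filter (fun q : Fin k × Fin k => q.1 ≠ q.2),
            n * (univ.filter fun V : Fin m × Fin k → Fin n => V (i, q.1) = V (i, q.2)).card := by
          rw [mul_sum]
      _ ≤ ∑ _q ∈ univ.filter (fun q : Fin k × Fin k => q.1 ≠ q.2),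
            Fintype.card (Fin m × Fin k → Fin n) := by
          refine sum_le_sum fun q hq => ?_
          have hne : (i, q.1) ≠ (i, q.2) := by
            intro h
            exact (mem_filter.1 hq).2 (Prod.ext_iff.1 h).2
          exact shwL_mul_card_coincide_le (i, q.1) (i, q.2) hne
      _ = (univ.filter fun q : Fin k × Fin k => q.1 ≠ q.2).card
            * Fintype.card (Fin m × Fin k → Fin n) := by rw [sum_const, smul_eq_mul]
      _ ≤ k ^ 2 * Fintype.card (Fin m × Fin k → Fin n) := by
          refine Nat.mul_le_mul_right _ ((card_le_univ _).trans ?_)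
          rw [Fintype.card_prod, Fintype.card_fin, sq]
  calc (univ.filter fun V : Fin m × Fin k → Fin n => r ≤ R V).card * r * n
      ≤ (∑ V : Fin m × Fin k → Fin n, R V) * n := Nat.mul_le_mul_right _ hmarkov
    _ = ∑ i : Fin m, n * (univ.filter fun V : Fin m × Fin k → Fin n =>
          ¬ Function.Injective fun j : Fin k => V (i, j)).card := by
        rw [hswap, sum_mul]; exact sum_congr rfl fun i _ => mul_comm _ _
    _ ≤ ∑ _i : Fin m, k ^ 2 * Fintype.card (Fin m × Fin k → Fin n) := sum_le_sum fun i _ => hclause i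
    _ = m * k ^ 2 * Fintype.card (Fin m × Fin k → Fin n) := by
        rw [sum_const, card_univ, Fintype.card_fin, smul_eq_mul, mul_assoc]

end Repeats

section Assembly

variable {m k n : ℕ}

/-- Instances of `F_k(n, m)` correspond to (variable pattern, sign pattern) pairs, so the number of
instances is `#patterns · #(sign cube)`. -/
theorem shwL_card_inst_eq :
    Fintype.card (Fin m → Fin k → Fin n × Bool)
      = Fintype.card (Fin m × Fin k → Fin n) * Fintype.card (Fin m × Fin k → Bool) := by
  simp only [Fintype.card_fun, Fintype.card_prod, Fintype.card_fin, Fintype.card_bool]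
  rw [← pow_mul, mul_pow, mul_comm k m]

/-- **Fibre decomposition over the variable pattern.** The number of instances solved by `A` is
the sum over variable patterns `V` of the number of sign patterns `S` solved by the restricted
solver `S ↦ A (V, S)`. -/
theorem shwL_card_solved_eq_sum (A : (Fin m → Fin k → Fin n × Bool) → (Fin n → Bool)) :
    (univ.filter fun Φ : Fin m → Fin k → Fin n × Bool => ∀ i, ∃ j, A Φ (Φ i j).1 = (Φ i j).2).card
      = ∑ V : Fin m × Fin k → Fin n, (univ.filter fun S : Fin m × Fin k → Bool =>
          ∀ i, ∃ j, A (fun i j => (V (i, j), S (i, j))) (V (i, j)) = S (i, j)).card := by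
  -- pass to pairs `(V, S)`
  have hpairs : (univ.filter fun Φ : Fin m → Fin k → Fin n × Bool =>
      ∀ i, ∃ j, A Φ (Φ i j).1 = (Φ i j).2).card
        = (((univ : Finset (Fin m × Fin k → Fin n)) ×ˢ (univ : Finset (Fin m × Fin k → Bool))).filter
            fun p => ∀ i, ∃ j, A (fun i j => (p.1 (i, j), p.2 (i, j))) (p.1 (i, j)) = p.2 (i, j)).card := by
    refine card_nbij' (fun Φ => (fun a => (Φ a.1 a.2).1, fun a => (Φ a.1 a.2).2))
      (fun p i j => (p.1 (i, j), p.2 (i, j))) ?_ ?_ ?_ ?_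
    · intro Φ hΦ
      simpa using hΦ
    · intro p hp
      simpa using hp
    · intro Φ _
      rfl
    · rintro ⟨V, S⟩ _
      rfl
  rw [hpairs, card_filter, sum_product]
  refine sum_congr rfl fun V _ => ?_
  rw [card_filter]

end Assembly

end Summit.PneNP.PneNP.Theorems
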